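import Summits.BirchSwinnertonDyer.Rank1Residual.X12.HeegnerIndexRoute
import Summits.BirchSwinnertonDyer.BirchSwinnertonDyer.Theorems.Rank1ResidualIntModelReduction
import Literature.NumberTheory.EllipticCurves.ComplexMultiplicationDeuring0Square
import Literature.NumberTheory.EllipticCurves.ComplexMultiplicationDeuring1728Square
import Mathlib.NumberTheory.LSeries.PrimesInAP
import HarnessLib

/-!
# `E[p]` is irreducible for EVERY elliptic curve over `ℚ` with `j = 0` (`p ≥ 5`) or `j = 1728` (`p` odd) — the irreducibility input of the X12 Matar–Nekovář route as a THEOREM on 67 of the 72 inert-bad core pairs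

HONEST FRAMING (cell `b2b-bsdres`, run/shared/lean/b2b/bsd-rank1-residual/, verbatim in every
file): the goal of the cell is to DELETE the COMBINATION-SHAPED residual classes of the
Birch–Swinnerton-Dyer formula for ALL analytic-rank `≤ 1` elliptic curves over `ℚ` — "full BSD
formula for every rank `≤ 1` curve in class `C`" assembled STRICTLY from published theorems — so
that the rank-`≤ 1` remainder becomes exactly the CONSTRUCTION-SHAPED classes, which are TYPED
(missing-input `Prop`s), NOT attempted. This is not "finishing BSD". Harvest seat 1 (census owner
of class X12), generation 14. Theorems only (no definition, no named fact, no axiom); X12 REMAINS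
CONSTRUCTION-SHAPED; nothing is booked; no label and no census number moves.

## Why this file

Referee 2, GEN 25, ruling R2-25.3 (REFEREE-2.md §25E): Matar–Nekovář, J. Théor. Nombres Bordeaux
31 (2019) Thm. 6.7 (1) (`MatarNekovar2019.thm67_sha_primary_trivial_of_irreducible`, lit p199938)
is ADMISSIBLE as a per-pair lever `T-MN19` on the X12 inert-bad core (72 census pairs
`cm ∧ r = 1 ∧ p ≥ 5 inert in K ∧ p ∣ N`, harvest-1 RECLASSIFY §GEN-7.2b / §GEN-13.1), under five
per-pair conditions, the first of which is **(a) `irr(p)` certified as a THEOREM or kernel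
certificate** ("non-surjectivity alone is not irreducibility"). After gen 13 (`GoodTwistRecords`,
`FrobeniusIrrRecords`) `irr(p)` was kernel for 7 of the 72 pairs and two-engine for 65. The 72
core curves have `j = 0` (52 pairs, CM by `ℤ[ζ₃]`), `j = 1728` (15 pairs, CM by `ℤ[i]`) or
`j ∈ {−3375, 8000}` (5 pairs). This file proves, once and for all and with NO hypothesis at `p`
(good, multiplicative or additive alike):

* `irr_of_j_eq_zero` — **`j(E) = 0` and `p ≥ 5` prime ⟹ `E[p]` is an irreducible
  `𝔽_p[G_ℚ]`-module**;
* `irr_of_j_eq_1728` — **`j(E) = 1728` and `p` an odd prime ⟹ `E[p]` is irreducible**;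

so that condition (a) is a THEOREM for 67 of the 72 core pairs (and for every other `j ∈ {0, 1728}`
pair of the census, e.g. the `j = 1728` pairs among the 21 additive `p = 3` X12 pairs of
RECLASSIFY §GEN-13.6 (a)); the five `j ∈ {−3375, 8000}` core pairs are the records of the sibling
file `GoodTwistRecordsD7D8.lean`. (Both statements are sharp: `y² = x³ + 1` has a rational `2`-torsion
point and every `j = 0` curve a rational `3`-isogeny; `y² = x³ + x` has rational `2`-torsion.)

## Proof (compositions of tree theorems BY NAME; ≈ Mazur 1978 Prop. 6.3 (1) + Deuring + Dirichlet)

1. `irr_of_frobeniusTrace_of_forall_ne_zero` — **Mazur's Frobenius criterion at the level of the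
   curve**: for a globally minimal `W/ℚ`, a good prime `ℓ ≠ p` such that `X² − a_ℓ X + ℓ` has NO
   root in `𝔽_p` forces `E[p]` to be irreducible: a `Γ_ℚ`-stable line carries an isogeny character
   `r` (Mazur 1978 §5; tree `Mazur1978.exists_isogenyCharacter`) with
   `r(φ_ℓ)² − a_ℓ r(φ_ℓ) + ℓ = 0` in `𝔽_p` (Prop. 6.3 (1); tree
   `Mazur1978.isogenyCharacter_sq_sub_frobeniusTrace_mul_add_eq_zero`). (The cell's integer-model
   form `IntModel.hasIrreducibleModPGaloisRep_of_intModel_of_noroot` is the same argument with a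
   kernel point count; here `a_ℓ` comes from a theorem instead.)
2. Deuring / Ireland–Rosen (tree THEOREMS `frobeniusTrace_eq_zero_of_j_eq_zero_of_mod_three_eq_two`,
   Ireland–Rosen Ch. 18 §3 Thm. 4, and `frobeniusTrace_eq_zero_of_j_eq_of_mod_four_eq_three`,
   Ch. 18 §4 Thm. 5): `a_ℓ = 0` at every good `ℓ ≡ 2 (mod 3)`, `ℓ ≠ 2`, when `j = 0`, and at every
   good `ℓ ≡ 3 (mod 4)`, `ℓ ≠ 3`, when `j = 1728`. Then `X² − a_ℓ X + ℓ = X² + ℓ` is root-free mod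
   `p` iff `−ℓ` is a quadratic non-residue mod `p`.
3. `exists_prime_gt_modEq_and_not_isSquare_neg` — **Dirichlet + a non-residue**: for an odd prime
   `p`, a modulus `m` prime to `p` and a class `a` prime to `m` there are arbitrarily large primes
   `ℓ ≡ a (mod m)` with `−ℓ` a non-residue mod `p` (Mathlib's Dirichlet theorem
   `Nat.forall_exists_prime_gt_and_eq_mod` on the class mod `m·p` assembled by the Chinese remainder
   theorem from `a` and `−c`, `c` a non-residue — `quadraticChar_exists_neg_one`). Taking
   `ℓ > max(p, |Δ_min|)` makes `ℓ ≠ p` and `ℓ` good. (`m = 3, a = 2` needs `p ≠ 3`; `m = 4, a = 3`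
   needs `p ≠ 2`; the non-residue needs `p ≠ 2`.)
4. §4: the cell-vocabulary corollaries — `Irr W p` for CM-by-`j` curves, and the Matar–Nekovář
   booking shape of `HeegnerIndexRoute.lean` (`X12.bsdp_of_matarNekovar_of_not_dvd_index`) with the
   `hirr` input DISCHARGED on `j = 0` / `j = 1728` pairs: remaining per-pair inputs are exactly the
   referee's (b)–(e) (Heegner field `K'` with the Heegner hypothesis, Heegner point of infinite order
   with `p ∤ [E(K') : ℤ y_{K'}]` by two implementations, `ord_p #Ш_an = 0`, `r_an ≤ 1`).

## What is NOT claimed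

Nothing is booked and no label moves; the Heegner index certificates (condition (d), two
implementations) are the instrument lanes'; X12 stays CONSTRUCTION-SHAPED (the class-level missing
object — a `p`-adic Gross–Zagier formula / signed main conjecture for CM Hecke characters at an
inert prime of additive reduction — is untouched by a per-pair certificate route).

References: B. Mazur, *Rational isogenies of prime degree*, Invent. Math. 44 (1978) §5 (p. 148),
§6 Prop. 6.3 (1) (p. 153) [Mazur1978]; K. Ireland, M. Rosen, *A Classical Introduction to Modern
Number Theory*, 2nd ed., GTM 84 (1990), Ch. 18 §3 Thm. 4 and §4 Thm. 5 [IrelandRosen1990];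
P. G. L. Dirichlet (1837) / Mathlib `Mathlib.NumberTheory.LSeries.PrimesInAP`; A. Matar, J. Nekovář,
J. Théor. Nombres Bordeaux 31 (2019) Thm. 6.7 (1) (p. 498) [MatarNekovar2019]; REFEREE-2.md §25E
(R2-25.3); harvest-1 RECLASSIFY.md §GEN-13 / §GEN-14.
-/

set_option autoImplicit false

noncomputable section

open scoped Classical

open IsDedekindDomain NumberField Rat.HeightOneSpectrum WeierstrassCurve
  Literature.NumberTheory.EllipticCurves Literature.NumberTheory.EllipticCurves.Rank1Residual
  Literature.NumberTheory.EllipticCurves.Rank1Residual.Typed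
  Literature.NumberTheory.GaloisRepresentations

namespace Summit.BirchSwinnertonDyer.Rank1Residual.X12

/-! ## §1 Dirichlet: primes in a prescribed class with `−ℓ` a non-residue mod `p` -/

/-- **Primes `ℓ ≡ a (mod m)`, as large as desired, with `−ℓ` a quadratic non-residue modulo an odd
prime `p ∤ m`.** (Dirichlet's theorem on the class of `ℤ/mp` that is `a` mod `m` and `−c` mod `p`,
`c` a non-residue mod `p`; Chinese remainder theorem.) [folklore] -/
theorem exists_prime_gt_modEq_and_not_isSquare_neg (p : ℕ) [hp : Fact p.Prime] (hp2 : p ≠ 2)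
    {m a : ℕ} (hm : m ≠ 0) (hmp : m.Coprime p) (ham : a.Coprime m) (n : ℕ) :
    ∃ ℓ : ℕ, n < ℓ ∧ ℓ.Prime ∧ ℓ ≡ a [MOD m] ∧ ¬ IsSquare (-(ℓ : ZMod p)) := by
  have hpp : p.Prime := hp.out
  obtain ⟨c, hc⟩ := quadraticChar_exists_neg_one (F := ZMod p)
    (by rw [ZMod.ringChar_zmod_n]; exact hp2)
  have hc0 : c ≠ 0 := fun h ↦ by
    rw [quadraticChar_eq_zero_iff.mpr h] at hc
    norm_num at hc
  set c₀ : ℕ := (-c).val with hc₀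
  have hc₀0 : c₀ ≠ 0 := (ZMod.val_ne_zero (-c)).mpr (neg_ne_zero.mpr hc0)
  have hc₀p : c₀ < p := ZMod.val_lt (-c)
  obtain ⟨k, hka, hkc⟩ := Nat.chineseRemainder hmp a c₀
  have hkm : k.Coprime m := by
    rw [Nat.Coprime, hka.gcd_eq]
    exact ham
  have hkp : k.Coprime p := by
    rw [Nat.Coprime, hkc.gcd_eq]
    exact ((Nat.Prime.coprime_iff_not_dvd hpp).mpr
      (Nat.not_dvd_of_pos_of_lt (Nat.pos_of_ne_zero hc₀0) hc₀p)).symm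
  have hkmp : k.Coprime (m * p) := Nat.Coprime.mul_right hkm hkp
  haveI : NeZero (m * p) := ⟨mul_ne_zero hm hpp.ne_zero⟩
  obtain ⟨ℓ, hℓn, hℓ, hℓk⟩ :=
    Nat.forall_exists_prime_gt_and_eq_mod ((ZMod.isUnit_iff_coprime k (m * p)).mpr hkmp) n
  have hmod : ℓ ≡ k [MOD m * p] := (ZMod.natCast_eq_natCast_iff ℓ k (m * p)).mp hℓk
  refine ⟨ℓ, hℓn, hℓ, (Nat.ModEq.of_mul_right p hmod).trans hka, ?_⟩
  have hℓp : (ℓ : ZMod p) = -c := by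
    rw [(ZMod.natCast_eq_natCast_iff ℓ c₀ p).mpr ((Nat.ModEq.of_mul_left m hmod).trans hkc), hc₀,
      ZMod.natCast_zmod_val]
  rw [hℓp, neg_neg]
  exact quadraticChar_neg_one_iff_not_isSquare.mp hc

/-! ## §2 Mazur's Frobenius criterion at the level of the curve -/

/-- **`E[p]` irreducible from ONE good prime `ℓ ≠ p` at which `X² − a_ℓ X + ℓ` has no root mod `p`**
(Mazur 1978 Prop. 6.3 (1): a `Γ_ℚ`-stable line in `E[p]` has an isogeny character `r` with
`r(φ_ℓ)² − a_ℓ r(φ_ℓ) + ℓ = 0` in `𝔽_p` at an arithmetic Frobenius `φ_ℓ`). For a globally minimal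
`W` (`a_ℓ = W.frobeniusTrace ℓ`). [cite: Mazur1978, §5 (p. 148) and §6 Prop. 6.3 (1) (p. 153)] -/
theorem irr_of_frobeniusTrace_of_forall_ne_zero (W : WeierstrassCurve ℚ) [W.IsElliptic]
    [W.IsGloballyMinimal] (p ℓ : ℕ) [hp : Fact p.Prime] [hℓ : Fact ℓ.Prime] (hℓp : ℓ ≠ p)
    (hgood : W.HasGoodReductionAtPrime ℓ)
    (hnoroot : ∀ t : ZMod p, t ^ 2 - (W.frobeniusTrace ℓ : ZMod p) * t + (ℓ : ZMod p) ≠ 0) :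
    W.HasIrreducibleModPGaloisRep p := by
  by_contra hred
  obtain ⟨H, hHstab, hHcard⟩ :=
    (Mazur1978.not_hasIrreducibleModPGaloisRep_iff_exists_natCard_eq W p).mp hred
  obtain ⟨P, hP0, hHP⟩ := Mazur1978.exists_eq_zmultiples_of_natCard_eq W p hHcard
  have hst : ∀ σ : Field.absoluteGaloisGroup ℚ, σ • P ∈ AddSubgroup.zmultiples P := fun σ ↦ by
    rw [← hHP]; exact hHstab σ P (hHP ▸ AddSubgroup.mem_zmultiples P)
  obtain ⟨r, hr⟩ := Mazur1978.exists_isogenyCharacter W p hP0 hst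
  set v : HeightOneSpectrum (𝓞 ℚ) := (primesEquiv (R := 𝓞 ℚ)).symm ⟨ℓ, hℓ.out⟩ with hvdef
  have hvℓ : (primesEquiv v : ℕ) = ℓ := by rw [hvdef, Equiv.apply_symm_apply]
  have hv : (ℓ : 𝓞 ℚ) ∈ v.asIdeal := by
    rw [DeuringLadic.natCast_mem_asIdeal_iff v ℓ, hvℓ]
  obtain ⟨𝔓, h𝔓⟩ := v.primesAbove_nonempty
  obtain ⟨φ, hφ⟩ := HeightOneSpectrum.exists_isArithFrobAt_of_mem_primesAbove_holds (v := v) h𝔓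
  exact hnoroot _ (Mazur1978.isogenyCharacter_sq_sub_frobeniusTrace_mul_add_eq_zero W p ℓ hℓp hgood
    hP0 hr hv h𝔓 hφ)

/-- The root-freeness in the supersingular shape: if `a_ℓ = 0` and `−ℓ` is a non-residue mod `p`,
then `X² − a_ℓ X + ℓ = X² + ℓ` has no root mod `p`. [folklore] -/
theorem forall_sq_sub_mul_add_ne_zero_of_trace_eq_zero_of_not_isSquare {p ℓ : ℕ} {a : ℤ}
    (ha : a = 0) (hns : ¬ IsSquare (-(ℓ : ZMod p))) (t : ZMod p) :
    t ^ 2 - (a : ZMod p) * t + (ℓ : ZMod p) ≠ 0 := by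
  subst ha
  intro h
  apply hns
  refine ⟨t, ?_⟩
  have : (ℓ : ZMod p) = -(t ^ 2) := by
    push_cast at h
    linear_combination h
  rw [this, neg_neg, sq]

/-! ## §3 The two theorems -/

/-- **`j = 0`, `p ≥ 5` ⟹ `E[p]` irreducible.** Let `W/ℚ` be a globally minimal elliptic curve with
`j(W) = 0` and `p ≥ 5` a prime (no hypothesis on the reduction of `W` at `p`). Then `ρ̄_{W,p}` is
irreducible. Proof: by Dirichlet pick a prime `ℓ ≡ 2 (mod 3)`, `ℓ > max(p, |Δ_min|)`, with `−ℓ`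
a non-residue mod `p`; `ℓ` is good and `a_ℓ = 0` (Ireland–Rosen 18.3 Thm. 4: `x ↦ x³` permutes
`𝔽_ℓ`), so `X² − a_ℓX + ℓ = X² + ℓ` is root-free mod `p`, and Mazur's Prop. 6.3 (1) applies.
(Sharp: every `j = 0` curve has a rational `3`-isogeny, and `y² = x³ + 1` a rational `2`-torsion
point.) [cite: Mazur1978, §6 Prop. 6.3 (1) (p. 153)] [cite: IrelandRosen1990, Ch. 18 §3, Theorem 4] -/
theorem irr_of_j_eq_zero (W : WeierstrassCurve ℚ) [W.IsElliptic] [W.IsGloballyMinimal]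
    (hj : W.j = 0) (p : ℕ) [hp : Fact p.Prime] (hp5 : 5 ≤ p) : W.HasIrreducibleModPGaloisRep p := by
  have hpp : p.Prime := hp.out
  have hp2 : p ≠ 2 := by omega
  have hp3 : p ≠ 3 := by omega
  have h3p : Nat.Coprime 3 p := (Nat.coprime_primes Nat.prime_three hpp).mpr (Ne.symm hp3)
  obtain ⟨ℓ, hℓn, hℓ, hℓ3, hns⟩ := exists_prime_gt_modEq_and_not_isSquare_neg p hp2
    (m := 3) (a := 2) (by norm_num) h3p (by norm_num) (max p (minimalDiscriminantInt W).natAbs)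
  haveI : Fact ℓ.Prime := ⟨hℓ⟩
  have hℓp : ℓ ≠ p := by
    rintro rfl
    exact absurd hℓn (not_lt.mpr (le_max_left _ _))
  have hℓ2 : ℓ ≠ 2 := by
    rintro rfl
    have : p < 2 := lt_of_le_of_lt (le_max_left _ _) hℓn
    omega
  have hℓΔ : ¬ (ℓ : ℤ) ∣ minimalDiscriminantInt W := by
    intro hdvd
    have h0 : minimalDiscriminantInt W ≠ 0 := minimalDiscriminantInt_ne_zero W
    have h1 : ℓ ∣ (minimalDiscriminantInt W).natAbs := by
      simpa using Int.natAbs_dvd_natAbs.mpr hdvd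
    have hle : ℓ ≤ (minimalDiscriminantInt W).natAbs := Nat.le_of_dvd (Int.natAbs_pos.mpr h0) h1
    exact absurd hℓn (not_lt.mpr ((le_max_right _ _).trans' hle))
  have hmod : ℓ % 3 = 2 := hℓ3
  have htr : W.frobeniusTrace ℓ = 0 :=
    frobeniusTrace_eq_zero_of_j_eq_zero_of_mod_three_eq_two W hj hℓ hmod hℓ2 hℓΔ
  exact irr_of_frobeniusTrace_of_forall_ne_zero W p ℓ hℓp
    (W.hasGoodReductionAtPrime_of_not_dvd ℓ hℓΔ)
    (forall_sq_sub_mul_add_ne_zero_of_trace_eq_zero_of_not_isSquare htr hns)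

/-- **`j = 1728`, `p` odd ⟹ `E[p]` irreducible.** Let `W/ℚ` be a globally minimal elliptic curve
with `j(W) = 1728` and `p` an odd prime (no hypothesis on the reduction at `p`). Then `ρ̄_{W,p}`
is irreducible: a Dirichlet prime `ℓ ≡ 3 (mod 4)`, `ℓ > max(p, |Δ_min|)`, with `−ℓ` a non-residue
mod `p` is good with `a_ℓ = 0` (Ireland–Rosen 18.4 Thm. 5, first assertion), and Mazur's
Prop. 6.3 (1) applies to the root-free `X² + ℓ`. (Sharp: `y² = x³ + Ax` has the rational `2`-torsion
point `(0,0)`.) [cite: Mazur1978, §6 Prop. 6.3 (1) (p. 153)] [cite: IrelandRosen1990, Ch. 18 §4, Theorem 5 (first assertion)] -/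
theorem irr_of_j_eq_1728 (W : WeierstrassCurve ℚ) [W.IsElliptic] [W.IsGloballyMinimal]
    (hj : W.j = 1728) (p : ℕ) [hp : Fact p.Prime] (hp2 : p ≠ 2) :
    W.HasIrreducibleModPGaloisRep p := by
  have hpp : p.Prime := hp.out
  have h4p : Nat.Coprime 4 p := by
    have h2p : Nat.Coprime 2 p := (Nat.coprime_primes Nat.prime_two hpp).mpr (Ne.symm hp2)
    have h := Nat.Coprime.pow_left 2 h2p
    norm_num at h
    exact h
  obtain ⟨ℓ, hℓn, hℓ, hℓ4, hns⟩ := exists_prime_gt_modEq_and_not_isSquare_neg p hp2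
    (m := 4) (a := 3) (by norm_num) h4p (by norm_num) (max p (minimalDiscriminantInt W).natAbs)
  haveI : Fact ℓ.Prime := ⟨hℓ⟩
  have hℓp : ℓ ≠ p := by
    rintro rfl
    exact absurd hℓn (not_lt.mpr (le_max_left _ _))
  have hℓ3 : ℓ ≠ 3 := by
    rintro rfl
    have : p < 3 := lt_of_le_of_lt (le_max_left _ _) hℓn
    have := hpp.two_le
    omega
  have hℓΔ : ¬ (ℓ : ℤ) ∣ minimalDiscriminantInt W := by
    intro hdvd
    have h0 : minimalDiscriminantInt W ≠ 0 := minimalDiscriminantInt_ne_zero W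
    have h1 : ℓ ∣ (minimalDiscriminantInt W).natAbs := by
      simpa using Int.natAbs_dvd_natAbs.mpr hdvd
    have hle : ℓ ≤ (minimalDiscriminantInt W).natAbs := Nat.le_of_dvd (Int.natAbs_pos.mpr h0) h1
    exact absurd hℓn (not_lt.mpr ((le_max_right _ _).trans' hle))
  have hmod : ℓ % 4 = 3 := hℓ4
  have htr : W.frobeniusTrace ℓ = 0 :=
    frobeniusTrace_eq_zero_of_j_eq_of_mod_four_eq_three W hj hℓ hmod hℓ3 hℓΔ
  exact irr_of_frobeniusTrace_of_forall_ne_zero W p ℓ hℓp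
    (W.hasGoodReductionAtPrime_of_not_dvd ℓ hℓΔ)
    (forall_sq_sub_mul_add_ne_zero_of_trace_eq_zero_of_not_isSquare htr hns)

/-! ## §4 Cell vocabulary: `Irr`, `¬ Red`, and the Matar–Nekovář booking shape with `irr(p)` discharged -/

section Cell

variable (W : WeierstrassCurve ℚ) [W.IsElliptic] [W.IsGloballyMinimal] (p : ℕ) [hp : Fact p.Prime]

/-- `irr(p)` for every `j = 0` curve at every prime `p ≥ 5` (cell predicate `Irr`). [cite: Mazur1978, §6 Prop. 6.3 (1) (p. 153)] [cite: IrelandRosen1990, Ch. 18 §3, Theorem 4] -/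
theorem irr_of_j_eq_zero_of_five_le (hj : W.j = 0) (hp5 : 5 ≤ p) : Irr W p :=
  irr_of_j_eq_zero W hj p hp5

/-- `irr(p)` for every `j = 1728` curve at every odd prime `p` (cell predicate `Irr`). [cite: Mazur1978, §6 Prop. 6.3 (1) (p. 153)] [cite: IrelandRosen1990, Ch. 18 §4, Theorem 5 (first assertion)] -/
theorem irr_of_j_eq_1728_of_ne_two (hj : W.j = 1728) (hp2 : p ≠ 2) : Irr W p :=
  irr_of_j_eq_1728 W hj p hp2

/-- A `j = 0` curve is never Eisenstein at `p ≥ 5` (`¬ Red`). [cite: Mazur1978, §6 Prop. 6.3 (1) (p. 153)] -/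
theorem not_red_of_j_eq_zero_of_five_le (hj : W.j = 0) (hp5 : 5 ≤ p) : ¬ Red W p :=
  fun h ↦ h (irr_of_j_eq_zero W hj p hp5)

/-- A `j = 1728` curve is never Eisenstein at an odd prime (`¬ Red`). [cite: Mazur1978, §6 Prop. 6.3 (1) (p. 153)] -/
theorem not_red_of_j_eq_1728_of_ne_two (hj : W.j = 1728) (hp2 : p ≠ 2) : ¬ Red W p :=
  fun h ↦ h (irr_of_j_eq_1728 W hj p hp2)

/-- **X12 core, `j = 0` pairs (52 of 72): the Matar–Nekovář booking shape with `irr(p)` DISCHARGED.**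
For an X12 pair `(E, p)` (`ClassX12 W p`: CM, `r_an = 1`) with `j(E) = 0` and `p ≥ 5`: granted the
PUBLISHED named fact `hMN` (Matar–Nekovář 2019 Thm. 6.7 (1)) and GZK, the per-pair certificate —
`K'` imaginary quadratic with the Heegner hypothesis for `N`, a Heegner point `P = y_{K'}` of
infinite order with `p ∤ [E(K') : ℤP]`, `#Ш_an = q` with `ord_p q = 0` — gives Miller's `BSD(E,p)`.
`irr(p)` is `irr_of_j_eq_zero` (no engine). Per pair; nothing booked (referee conditions (b)–(e)
of R2-25.3 are the remaining inputs). [cite: MatarNekovar2019, Thm. 6.7 (1) (p. 498)] [cite: Mazur1978, §6 Prop. 6.3 (1) (p. 153)] [cite: Miller2011LMS, §1 and Def. 1.1] -/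
theorem bsdp_of_matarNekovar_of_j_eq_zero
    (hGZK : rank_eq_analyticRank_of_analyticRank_le_one)
    {N : ℕ} [NeZero N] {K' : Type} [Field K'] [NumberField K']
    (hMN : MatarNekovar2019.thm67_sha_primary_trivial_of_irreducible N W K')
    (hX : ClassX12 W p) (hj : W.j = 0) (hp5 : 5 ≤ p)
    (hK' : IsImaginaryQuadratic K') (hH : SatisfiesHeegnerHypothesis N K')
    {P : (W.baseChange K').toAffine.Point} (hP : IsHeegnerPoint N W K' P) (hnt : ¬ IsOfFinAddOrder P)
    (hI : ¬ p ∣ (AddSubgroup.zmultiples P).index)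
    {q : ℚ} (hq : shaAn W = (q : ℂ)) (hv : padicValRat p q = 0) : BSDp W p :=
  bsdp_of_matarNekovar_of_not_dvd_index W p hGZK hMN hX hp5 hK' hH hP hnt hI
    (irr_of_j_eq_zero W hj p hp5) hq hv

/-- **X12 core, `j = 1728` pairs (15 of 72): the booking shape with `irr(p)` DISCHARGED** (as
`bsdp_of_matarNekovar_of_j_eq_zero`, `irr(p)` from `irr_of_j_eq_1728`). [cite: MatarNekovar2019, Thm. 6.7 (1) (p. 498)] [cite: Mazur1978, §6 Prop. 6.3 (1) (p. 153)] [cite: Miller2011LMS, §1 and Def. 1.1] -/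
theorem bsdp_of_matarNekovar_of_j_eq_1728
    (hGZK : rank_eq_analyticRank_of_analyticRank_le_one)
    {N : ℕ} [NeZero N] {K' : Type} [Field K'] [NumberField K']
    (hMN : MatarNekovar2019.thm67_sha_primary_trivial_of_irreducible N W K')
    (hX : ClassX12 W p) (hj : W.j = 1728) (hp5 : 5 ≤ p)
    (hK' : IsImaginaryQuadratic K') (hH : SatisfiesHeegnerHypothesis N K')
    {P : (W.baseChange K').toAffine.Point} (hP : IsHeegnerPoint N W K' P) (hnt : ¬ IsOfFinAddOrder P)
    (hI : ¬ p ∣ (AddSubgroup.zmultiples P).index)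
    {q : ℚ} (hq : shaAn W = (q : ℂ)) (hv : padicValRat p q = 0) : BSDp W p :=
  bsdp_of_matarNekovar_of_not_dvd_index W p hGZK hMN hX hp5 hK' hH hP hnt hI
    (irr_of_j_eq_1728 W hj p (by omega)) hq hv

/-- The `r_an ≤ 1` form (no `ClassX12` wrapper) on a `j = 0` pair, `p ≥ 5`. [cite: MatarNekovar2019, Thm. 6.7 (1) (p. 498)] [cite: Miller2011LMS, §1 and Def. 1.1] -/
theorem bsdp_of_matarNekovar_of_j_eq_zero'
    (hGZK : rank_eq_analyticRank_of_analyticRank_le_one)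
    {N : ℕ} [NeZero N] {K' : Type} [Field K'] [NumberField K']
    (hMN : MatarNekovar2019.thm67_sha_primary_trivial_of_irreducible N W K')
    (hr : W.analyticRank ≤ 1) (hj : W.j = 0) (hp5 : 5 ≤ p)
    (hK' : IsImaginaryQuadratic K') (hH : SatisfiesHeegnerHypothesis N K')
    {P : (W.baseChange K').toAffine.Point} (hP : IsHeegnerPoint N W K' P) (hnt : ¬ IsOfFinAddOrder P)
    (hI : ¬ p ∣ (AddSubgroup.zmultiples P).index)
    {q : ℚ} (hq : shaAn W = (q : ℂ)) (hv : padicValRat p q = 0) : BSDp W p :=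
  bsdp_of_matarNekovar_of_not_dvd_index' W p hGZK hMN hr hp5 hK' hH hP hnt hI
    (irr_of_j_eq_zero W hj p hp5) hq hv

/-- The `r_an ≤ 1` form on a `j = 1728` pair at ANY odd prime `p` (so also the `j = 1728` pairs
among the additive `p = 3` X12 pairs of RECLASSIFY §GEN-13.6 (a); there `K' ≠ ℚ(√−3)` is the
extra proviso of Thm. 6.7 (1), automatic when `3 ∣ N` splits in `K'`).
[cite: MatarNekovar2019, Thm. 6.7 (1) (p. 498)] [cite: Miller2011LMS, §1 and Def. 1.1] -/
theorem bsdp_of_matarNekovar_of_j_eq_1728'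
    (hGZK : rank_eq_analyticRank_of_analyticRank_le_one)
    {N : ℕ} [NeZero N] {K' : Type} [Field K'] [NumberField K']
    (hMN : MatarNekovar2019.thm67_sha_primary_trivial_of_irreducible N W K')
    (hr : W.analyticRank ≤ 1) (hj : W.j = 1728) (hp2 : p ≠ 2)
    (h3 : p = 3 → NumberField.discr K' ≠ -3)
    (hK' : IsImaginaryQuadratic K') (hH : SatisfiesHeegnerHypothesis N K')
    {P : (W.baseChange K').toAffine.Point} (hP : IsHeegnerPoint N W K' P) (hnt : ¬ IsOfFinAddOrder P)
    (hI : ¬ p ∣ (AddSubgroup.zmultiples P).index)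
    {q : ℚ} (hq : shaAn W = (q : ℂ)) (hv : padicValRat p q = 0) : BSDp W p :=
  Typed.bsdp_of_matarNekovar_of_not_dvd_index W p hGZK hMN hK' hH hP hnt hp2
    (irr_of_j_eq_1728 W hj p hp2) h3 hI hr hq hv

/-- … and the typed residue `X12.MissingInputAt W p` on a `j = 0` X12 pair at `p ≥ 5` from the
same certificate. [cite: MatarNekovar2019, Thm. 6.7 (1) (p. 498)] [cite: Miller2011LMS, Def. 1.1] -/
theorem missingInputAt_of_matarNekovar_of_j_eq_zero
    (hGZK : rank_eq_analyticRank_of_analyticRank_le_one)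
    {N : ℕ} [NeZero N] {K' : Type} [Field K'] [NumberField K']
    (hMN : MatarNekovar2019.thm67_sha_primary_trivial_of_irreducible N W K')
    (hX : ClassX12 W p) (hj : W.j = 0) (hp5 : 5 ≤ p)
    (hK' : IsImaginaryQuadratic K') (hH : SatisfiesHeegnerHypothesis N K')
    {P : (W.baseChange K').toAffine.Point} (hP : IsHeegnerPoint N W K' P) (hnt : ¬ IsOfFinAddOrder P)
    (hI : ¬ p ∣ (AddSubgroup.zmultiples P).index)
    {q : ℚ} (hq : shaAn W = (q : ℂ)) (hv : padicValRat p q = 0) : X12.MissingInputAt W p :=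
  missingInputAt_of_matarNekovar_of_not_dvd_index W p hGZK hMN hX hp5 hK' hH hP hnt hI
    (irr_of_j_eq_zero W hj p hp5) hq hv

/-- … and on a `j = 1728` X12 pair at `p ≥ 5`. [cite: MatarNekovar2019, Thm. 6.7 (1) (p. 498)] [cite: Miller2011LMS, Def. 1.1] -/
theorem missingInputAt_of_matarNekovar_of_j_eq_1728
    (hGZK : rank_eq_analyticRank_of_analyticRank_le_one)
    {N : ℕ} [NeZero N] {K' : Type} [Field K'] [NumberField K']
    (hMN : MatarNekovar2019.thm67_sha_primary_trivial_of_irreducible N W K')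
    (hX : ClassX12 W p) (hj : W.j = 1728) (hp5 : 5 ≤ p)
    (hK' : IsImaginaryQuadratic K') (hH : SatisfiesHeegnerHypothesis N K')
    {P : (W.baseChange K').toAffine.Point} (hP : IsHeegnerPoint N W K' P) (hnt : ¬ IsOfFinAddOrder P)
    (hI : ¬ p ∣ (AddSubgroup.zmultiples P).index)
    {q : ℚ} (hq : shaAn W = (q : ℂ)) (hv : padicValRat p q = 0) : X12.MissingInputAt W p :=
  missingInputAt_of_matarNekovar_of_not_dvd_index W p hGZK hMN hX hp5 hK' hH hP hnt hI
    (irr_of_j_eq_1728 W hj p (by omega)) hq hv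

end Cell

end Summit.BirchSwinnertonDyer.Rank1Residual.X12

end
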